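import Summits.ValiantsHypothesis.ValiantsHypothesis.Theorems.GrenetZeonDualUnipotentThreeHalvesHeavyTopPatternDefs

/-!
# `GrenetZeon.DualUnipotentThreeHalves` (stmt-ValiantsHypothesis-24318), R2 `HeavyTopLaw` instance grid — COORDINATE PATTERN PENCILS:
# Lemma A (the direction space may be taken COORDINATE) and THE PATH-PLACEMENT CRITERION `not_heavyTopInst_of_placement`

Experiment cell «val-heavytop-census» (D-0160), engine seat val-htc-eng-2 (g2).  Second half of the kernel port of val-idea-28 g3's
`MEMO-g3-degenerate-certificate.md` (§1 Lemma A, Step 2 «no Borel fixed point, no topology — polynomial identities and the echelon construction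
of in_λ(T)»; §3 S3 form «every directed (n−1)-path uses ≤ k edges of S′»), over `…HeavyTopPatternDefs` (Lemma B, torus intertwining).

* `wt_injective` — distinct coordinates of an injective strictly upper placement have distinct torus weights `2^j − 2^i`.
* `torus_patTop` — `diag(t^{2^i}) · patTop(t^{wt} · v) = patTop(v) · diag(t^{2^i})`; `isUnit_torus`.
* `finrank_le_card_initial` — the INITIAL COORDINATES of `K` (where some vector of `K` starts w.r.t. the weight order) number `≥ dim K`.
* ★★ **Lemma A** `words_vanish_on_coordinate_of_vanish` — if a set of words vanishes on all pairs `(patTop x, patTop v)`, `v ∈ K`, it vanishes on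
  all pairs `(patTop x, patTop u)`, `u` supported on the initial coordinates of `K`: the echelon vectors of `K` degenerate POLYNOMIALLY in `t`
  under the torus to the coordinate vectors, the hypothesis is torus-stable (intertwining), and a polynomial vanishing at all `t ≠ 0` vanishes.
* ★★★ **`not_heavyTopInst_of_placement`** — if the strictly upper entries of an `m × m` matrix carry `s + 1` directed `s`-paths (vertex rows
  `V a` with increasing consecutive entries) and `s + 1` further entries `X a`, all `(s+1)²` entries distinct, then `¬ HeavyTopInst (s+1) m`
  (`s + 1 ≤ 16`): a flag-cheap certificate `(K, k)` of the pattern pencil (`flagCheap_iff_wordTame`) makes every word of length `≤ s` with `> k`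
  tops vanish on `K` (`not_wordTame_of_word`), hence (Lemma A) on a coordinate set `E` with `dim K ≤ |E|`; by Lemma B each row path meets `E`
  in `≤ k` edges, so `|E| ≤ (s+1)(k+1) = (k+1)·n < dim K` — contradiction.  `not_heavyTopInst_of_placement_le`: the same for every `m' ≥ m`.

Scope (honest framing).  This is the S3-strength criterion (paths of length `n − 1` only); it re-derives ✓ `not_heavyTopInst_three_five`
(`NFive`: rows `[0,3,4],[0,1,4],[0,2,3]` …) and ✓ `not_heavyTopInst_four_seven` in one line each and decides the census's ✗-candidate rows; it
says nothing about R2 `HeavyTopLaw` itself (generic heavy-top pencils have no torus; MEMO-g3 §6), which is OPEN — as are the crux, rung 8062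
and `VP ≠ VNP`.  `--supports stmt-ValiantsHypothesis-24318`.  [MEMO-g3 §1, §3, §7; ✓ `…WordFlagPencil` (`flagCheap_iff_wordTame`,
`not_wordTame_of_word`); ✓ `…HeavyTopInstFourSevenToolkit` (`finrank_le_of_forall_apply_eq_zero`); this seat]
-/

-- `Summit.ValiantsHypothesis.ValiantsHypothesis.…` repeats a component (D-0017 layout); `dupNamespace` would flag the mandated name.
set_option linter.dupNamespace false
set_option autoImplicit false

noncomputable section

namespace Summit.ValiantsHypothesis.ValiantsHypothesis.Theorems.GrenetZeon.RadicalSplit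

open MvPolynomial Matrix
open scoped BigOperators
open Summit.ValiantsHypothesis.ValiantsHypothesis.Cruxes.TwoDimCoefficients.DimTwoCases (AffMat IsAffine)

/-! ## Lemma A (val-idea-28 g3 MEMO-g3 §1, S3 form): the direction space of a pattern pencil may be taken COORDINATE -/

section Reduction

variable {n m : ℕ}

/-- `2^j − 2^i` with `i < j` determines `j`: it lies in `[2^{j−1}, 2^j)`. -/
private theorem two_pow_sub_lt_aux (i : ℕ) {j i' j' : ℕ} (hij' : i' < j') (hjj' : j < j') :
    2 ^ j - 2 ^ i < 2 ^ j' - 2 ^ i' := by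
  have h1 : 2 ^ j - 2 ^ i < 2 ^ j := Nat.sub_lt (by positivity) (by positivity)
  have h2 : 2 ^ j ≤ 2 ^ (j' - 1) := Nat.pow_le_pow_right (by norm_num) (by omega)
  have h3 : 2 ^ i' ≤ 2 ^ (j' - 1) := Nat.pow_le_pow_right (by norm_num) (by omega)
  have h4 : 2 ^ j' = 2 * 2 ^ (j' - 1) := by
    rw [← Nat.pow_succ']
    congr 1
    omega
  omega

/-- **Distinct coordinates have distinct torus weights** (injective strictly upper placement): `2^j − 2^i` determines `(i, j)`. -/
theorem wt_injective (pos : Fin n × Fin n → Fin m × Fin m) (hinj : Function.Injective pos)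
    (hup : ∀ c, (pos c).1 < (pos c).2) : Function.Injective (wt pos) := by
  intro c c' h
  simp only [wt] at h
  have hc := Fin.lt_def.1 (hup c)
  have hc' := Fin.lt_def.1 (hup c')
  obtain hlt | heq | hgt := lt_trichotomy ((pos c).2 : ℕ) ((pos c').2 : ℕ)
  · exact absurd h (ne_of_lt (two_pow_sub_lt_aux _ hc' hlt))
  · have h2 : 2 ^ ((pos c).1 : ℕ) < 2 ^ ((pos c).2 : ℕ) := Nat.pow_lt_pow_right (by norm_num) hc
    have h2' : 2 ^ ((pos c').1 : ℕ) < 2 ^ ((pos c').2 : ℕ) := Nat.pow_lt_pow_right (by norm_num) hc'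
    rw [heq] at h h2
    have hi : (2 : ℕ) ^ ((pos c).1 : ℕ) = 2 ^ ((pos c').1 : ℕ) := by omega
    have hi' := Nat.pow_right_injective (le_refl 2) hi
    exact hinj (Prod.ext (Fin.ext hi') (Fin.ext heq))
  · exact absurd h.symm (ne_of_lt (two_pow_sub_lt_aux _ hc hgt))

/-- **The torus acts on tops through the weights**: `diag(t^{2^i}) · patTop(t^{wt} · v) = patTop(v) · diag(t^{2^i})`. -/
theorem torus_patTop (pos : Fin n × Fin n → Fin m × Fin m) (hup : ∀ c, (pos c).1 < (pos c).2) (t : ℂ)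
    (v : Fin n × Fin n → ℂ) :
    Matrix.diagonal (fun i : Fin m => t ^ (2 ^ (i : ℕ))) * patTop pos (fun c => t ^ wt pos c * v c) =
      patTop pos v * Matrix.diagonal (fun i : Fin m => t ^ (2 ^ (i : ℕ))) := by
  ext i j
  rw [Matrix.diagonal_mul, Matrix.mul_diagonal]
  simp only [patTop, Finset.mul_sum, Finset.sum_mul]
  refine Finset.sum_congr rfl fun c _ => ?_
  split_ifs with hc
  · have hij : (2 : ℕ) ^ (i : ℕ) ≤ 2 ^ (j : ℕ) := by
      have h1 := hup c
      rw [hc] at h1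
      exact Nat.pow_le_pow_right (by norm_num) (le_of_lt (Fin.lt_def.1 h1))
    have hw : wt pos c = 2 ^ (j : ℕ) - 2 ^ (i : ℕ) := by simp [wt, hc]
    rw [hw, ← mul_assoc, ← pow_add, Nat.add_sub_cancel' hij, mul_comm]
  · simp

/-- The torus element `diag(t^{2^i})`, `t ≠ 0`, is invertible. -/
theorem isUnit_torus (t : ℂ) (ht : t ≠ 0) : IsUnit (Matrix.diagonal fun i : Fin m => t ^ (2 ^ (i : ℕ))) := by
  rw [Matrix.isUnit_iff_isUnit_det, Matrix.det_diagonal, isUnit_iff_ne_zero]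
  exact Finset.prod_ne_zero_iff.2 fun i _ => pow_ne_zero _ ht

open scoped Classical in
/-- **INITIAL COORDINATES bound the dimension.**  The coordinates `c` at which some vector of `K` STARTS (nonzero at `c`, zero at all
coordinates of smaller weight) number at least `dim K`: the projection of `K` to them is injective (a nonzero vector starts somewhere). -/
theorem finrank_le_card_initial (pos : Fin n × Fin n → Fin m × Fin m) (K : Submodule ℂ (Fin n × Fin n → ℂ)) :
    Module.finrank ℂ K ≤
      (Finset.univ.filter fun c => ∃ v ∈ K, v c ≠ 0 ∧ ∀ c', wt pos c' < wt pos c → v c' = 0).card := by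
  classical
  set L := Finset.univ.filter fun c => ∃ v ∈ K, v c ≠ 0 ∧ ∀ c', wt pos c' < wt pos c → v c' = 0 with hL
  -- a vector of K vanishing at every initial coordinate vanishes
  have hkey : ∀ v ∈ K, (∀ c ∈ L, v c = 0) → v = 0 := by
    intro v hv hvL
    by_contra hv0
    obtain ⟨c₁, hc₁⟩ : ∃ c, v c ≠ 0 := by
      by_contra hall
      push Not at hall
      exact hv0 (funext hall)
    set S := Finset.univ.filter fun c => v c ≠ 0 with hS
    have hne : S.Nonempty := ⟨c₁, by simp [hS, hc₁]⟩
    obtain ⟨c₀, hc₀S, hmin⟩ := S.exists_min_image (wt pos) hne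
    have hc₀ : v c₀ ≠ 0 := by simpa [hS] using hc₀S
    have hc₀L : c₀ ∈ L := by
      simp only [hL, Finset.mem_filter, Finset.mem_univ, true_and]
      refine ⟨v, hv, hc₀, fun c' hc' => ?_⟩
      by_contra hvc'
      have : wt pos c₀ ≤ wt pos c' := hmin c' (by simp [hS, hvc'])
      omega
    exact hc₀ (hvL c₀ hc₀L)
  -- the coordinate projection onto L, restricted to K, is injective
  let φ : (Fin n × Fin n → ℂ) →ₗ[ℂ] (Fin n × Fin n → ℂ) :=
    LinearMap.pi fun c => if c ∈ L then LinearMap.proj c else 0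
  have hφ : ∀ v c, φ v c = if c ∈ L then v c else 0 := by
    intro v c
    simp only [φ, LinearMap.pi_apply]
    split_ifs <;> simp
  let f := φ.domRestrict K
  have hf : Function.Injective f := by
    intro a b hab
    apply Subtype.ext
    have h0 : (a : Fin n × Fin n → ℂ) - b = 0 := by
      refine hkey _ (K.sub_mem a.2 b.2) fun c hc => ?_
      have := congr_fun hab c
      simp only [f, LinearMap.domRestrict_apply, hφ, hc, ↓reduceIte] at this
      simp [this]
    exact sub_eq_zero.1 h0
  have h1 := LinearMap.finrank_range_of_inj hf
  have h2 : Module.finrank ℂ (LinearMap.range f) ≤ Fintype.card (Fin n × Fin n) - Lᶜ.card :=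
    finrank_le_of_forall_apply_eq_zero _ Lᶜ fun u hu c hc => by
      obtain ⟨a, rfl⟩ := LinearMap.mem_range.1 hu
      simp only [f, LinearMap.domRestrict_apply, hφ, (Finset.mem_compl.1 hc), ↓reduceIte]
  have h3 := Finset.card_compl L
  have h4 : L.card ≤ Fintype.card (Fin n × Fin n) := Finset.card_le_univ L
  omega

/-- **Lemma A (S3 form; val-idea-28 g3 MEMO-g3 §1, Step 2 without topology).**  For an injective strictly upper placement: if a set
`W` of words vanishes on every pair `(patTop x, patTop v)`, `x` arbitrary, `v ∈ K`, then it vanishes on every pair `(patTop x, patTop u)`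
with `u` supported on a COORDINATE set `E` of size `≥ dim K` — the initial coordinates of `K` for the torus weights.  Proof: the torus
`diag(t^{2^i})` preserves the hypothesis (conjugation-equivariance of word vanishing, `x ↦ t^{-wt}·x` bijective), the echelon vectors of `K`
degenerate POLYNOMIALLY in `t` to the coordinate vectors `e_c`, `c ∈ E`, and a matrix of polynomials in `t` vanishing for all `t ≠ 0`
vanishes at `t = 0`. -/
theorem words_vanish_on_coordinate_of_vanish (pos : Fin n × Fin n → Fin m × Fin m) (hinj : Function.Injective pos)
    (hup : ∀ c, (pos c).1 < (pos c).2) (K : Submodule ℂ (Fin n × Fin n → ℂ)) (W : Set (List Bool))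
    (hK : ∀ x v : Fin n × Fin n → ℂ, v ∈ K → ∀ w ∈ W, word (patTop pos x) (patTop pos v) w = 0) :
    ∃ E : Finset (Fin n × Fin n), Module.finrank ℂ K ≤ E.card ∧
      ∀ x u : Fin n × Fin n → ℂ, (∀ c, c ∉ E → u c = 0) → ∀ w ∈ W, word (patTop pos x) (patTop pos u) w = 0 := by
  classical
  have hwinj := wt_injective pos hinj hup
  set L := Finset.univ.filter fun c => ∃ v ∈ K, v c ≠ 0 ∧ ∀ c', wt pos c' < wt pos c → v c' = 0 with hL
  refine ⟨L, finrank_le_card_initial pos K, ?_⟩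
  intro x u hu w hwW
  -- echelon vectors: `b c ∈ K` starts at `c` with coefficient `1`, for `c ∈ L`
  have hb : ∀ c : Fin n × Fin n, ∃ b : Fin n × Fin n → ℂ,
      c ∈ L → b ∈ K ∧ b c = 1 ∧ ∀ c', wt pos c' < wt pos c → b c' = 0 := by
    intro c
    by_cases hc : c ∈ L
    · obtain ⟨v, hv, hvc, hv'⟩ : ∃ v ∈ K, v c ≠ 0 ∧ ∀ c', wt pos c' < wt pos c → v c' = 0 := by
        simpa [hL] using hc
      refine ⟨(v c)⁻¹ • v, fun _ => ⟨K.smul_mem _ hv, by simp [hvc], fun c' hc' => by simp [hv' c' hc']⟩⟩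
    · exact ⟨0, fun h => absurd h hc⟩
  choose b hb using hb
  have hbK : ∀ c ∈ L, b c ∈ K := fun c hc => (hb c hc).1
  have hbc : ∀ c ∈ L, b c c = 1 := fun c hc => (hb c hc).2.1
  have hb0 : ∀ c ∈ L, ∀ c', wt pos c' < wt pos c → b c c' = 0 := fun c hc => (hb c hc).2.2
  -- `b c c' ≠ 0` forces `wt c ≤ wt c'`
  have hble : ∀ c ∈ L, ∀ c', b c c' ≠ 0 → wt pos c ≤ wt pos c' := fun c hc c' h => by
    by_contra hlt
    exact h (hb0 c hc c' (by omega))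
  -- the polynomial family `U(t) = Σ_c u_c t^{-wt c} (t · b c)`, polynomial by the echelon property
  let U : Fin n × Fin n → Polynomial ℂ := fun c' =>
    ∑ c ∈ L, Polynomial.C (u c * b c c') * Polynomial.X ^ (wt pos c' - wt pos c)
  -- (A) at `t = 0` the family is `u`
  have hU0 : (fun c' => (U c').eval 0) = u := by
    funext c'
    simp only [U, Polynomial.eval_finsetSum, Polynomial.eval_mul, Polynomial.eval_C, Polynomial.eval_pow,
      Polynomial.eval_X]
    by_cases hc' : c' ∈ L
    · rw [Finset.sum_eq_single c']
      · simp [hbc c' hc']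
      · intro c hc hcc'
        by_cases hbz : b c c' = 0
        · simp [hbz]
        · have hle := hble c hc c' hbz
          have hne : wt pos c ≠ wt pos c' := fun h => hcc' (hwinj h)
          have hpos : wt pos c' - wt pos c ≠ 0 := by omega
          simp [zero_pow hpos]
      · exact fun h => absurd hc' h
    · rw [hu c' hc']
      refine Finset.sum_eq_zero fun c hc => ?_
      by_cases hbz : b c c' = 0
      · simp [hbz]
      · have hle := hble c hc c' hbz
        have hne : wt pos c ≠ wt pos c' := fun h => hc' (hwinj h ▸ hc)
        have hpos : wt pos c' - wt pos c ≠ 0 := by omega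
        simp [zero_pow hpos]
  -- (B) at `t ≠ 0` the family is the torus image of a vector of `K`
  have hUt : ∀ t : ℂ, t ≠ 0 → ∃ v ∈ K, (fun c' => (U c').eval t) = fun c' => t ^ wt pos c' * v c' := by
    intro t ht
    refine ⟨∑ c ∈ L, (u c * t⁻¹ ^ wt pos c) • b c, K.sum_mem fun c hc => K.smul_mem _ (hbK c hc), ?_⟩
    funext c'
    simp only [U, Polynomial.eval_finsetSum, Polynomial.eval_mul, Polynomial.eval_C, Polynomial.eval_pow,
      Polynomial.eval_X, Finset.sum_apply, Pi.smul_apply, smul_eq_mul, Finset.mul_sum]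
    refine Finset.sum_congr rfl fun c hc => ?_
    by_cases hbz : b c c' = 0
    · simp [hbz]
    · have hle := hble c hc c' hbz
      have hsplit : t ^ wt pos c' = t ^ (wt pos c' - wt pos c) * t ^ wt pos c := by
        rw [← pow_add, Nat.sub_add_cancel hle]
      have hcancel : t ^ wt pos c * t⁻¹ ^ wt pos c = 1 := by
        rw [← mul_pow, mul_inv_cancel₀ ht, one_pow]
      calc u c * b c c' * t ^ (wt pos c' - wt pos c)
          = u c * b c c' * t ^ (wt pos c' - wt pos c) * (t ^ wt pos c * t⁻¹ ^ wt pos c) := by rw [hcancel, mul_one]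
        _ = t ^ wt pos c' * (u c * t⁻¹ ^ wt pos c * b c c') := by rw [hsplit]; ring
  -- (C) the words of `W` vanish along the family for every `t ≠ 0`
  have hvan : ∀ t : ℂ, t ≠ 0 → word (patTop pos x) (patTop pos fun c' => (U c').eval t) w = 0 := by
    intro t ht
    obtain ⟨v, hvK, hv⟩ := hUt t ht
    rw [hv]
    set x' : Fin n × Fin n → ℂ := fun c => t⁻¹ ^ wt pos c * x c with hx'
    have hx : x = fun c => t ^ wt pos c * x' c := by
      funext c
      simp only [hx']
      rw [← mul_assoc, ← mul_pow, mul_inv_cancel₀ ht, one_pow, one_mul]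
    have hA := torus_patTop pos hup t x'
    have hB := torus_patTop pos hup t v
    rw [← hx] at hA
    have h0 : word (patTop pos x') (patTop pos v) w = 0 := hK x' v hvK w hwW
    rw [word_eq_gword] at h0 ⊢
    exact (gword_eq_zero_iff_of_intertwine _ _ _ _ _ (isUnit_torus t ht) hA hB w).1 h0
  -- (D) the polynomial identity: the word along the POLYNOMIAL family vanishes identically, in particular at `t = 0`
  let Wp := gword ((patTop pos x).map Polynomial.C) (patTop pos U) w
  have hWp : ∀ t : ℂ, Wp.map (Polynomial.eval t) = gword (patTop pos x) (patTop pos fun c' => (U c').eval t) w := by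
    intro t
    simp only [Wp]
    rw [← Polynomial.coe_evalRingHom, gword_map, Matrix.map_map, patTop_map]
    congr 1
    ext i j
    simp
  have hWp0 : Wp = 0 := by
    refine Matrix.ext fun i j => ?_
    apply Polynomial.eq_zero_of_infinite_isRoot
    refine ((Set.finite_singleton (0 : ℂ)).infinite_compl).mono fun t ht => ?_
    have ht' : t ≠ 0 := by simpa using ht
    have h := congr_fun (congr_fun (hWp t) i) j
    rw [← word_eq_gword, hvan t ht'] at h
    simpa [Polynomial.IsRoot] using h
  have h := hWp 0
  rw [hWp0, hU0, ← word_eq_gword] at h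
  simpa using h.symm

end Reduction

section Placement

variable {s m : ℕ}

/-- **THE PATH-PLACEMENT CRITERION** (uniform negative criterion of the `HeavyTopInst` grid; MEMO-g3 Lemma A + Lemma B in S3 form).
If the strictly upper entries of an `m × m` matrix carry `s + 1` directed paths of length `s` — vertex sequences `V a` with increasing
consecutive entries — and `s + 1` further entries `X a`, all `(s+1)²` entries DISTINCT, then `HeavyTopInst (s+1) m` is FALSE
(for `s + 1 ≤ 16`, where the heavy-top hypothesis is vacuous): the pattern pencil of the placement is affine, nilpotent, and not
flag-cheap — a flag-cheap certificate `(K, k)` would (Lemma A) give `dim K ≤ |E|` for a coordinate set `E` meeting every row path in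
`≤ k` edges (Lemma B + `not_wordTame_of_word`: a row word with `> k` letters in `E` is a NONZERO word of length `s ≤ n − 1`), so
`|E| ≤ (s+1)(k+1) ≤ (k+1)·n < dim K`. -/
theorem not_heavyTopInst_of_placement (hn : s + 1 ≤ 16) (V : Fin (s + 1) → Fin (s + 1) → Fin m)
    (X : Fin (s + 1) → Fin m × Fin m) (hinj : Function.Injective (placement V X))
    (hup : ∀ c, (placement V X c).1 < (placement V X c).2) : ¬ HeavyTopInst (s + 1) m := by
  classical
  intro H
  set pos := placement V X with hpos
  -- the pattern pencil is an admissible input of the instance (heavy-top hypothesis vacuous for `n ≤ 16`)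
  have hFC : FlagCheap (s + 1) m (patPencil pos) := by
    refine H (patPencil pos) (isAffine_patPencil pos) (patPencil_pow_eq_zero pos hup) fun K _ => ?_
    have h1 := Submodule.finrank_le K
    rw [Module.finrank_fintype_fun_eq_card, Fintype.card_prod, Fintype.card_fin] at h1
    have h2 : (s + 1) * (s + 1) ≤ 16 * (s + 1) := Nat.mul_le_mul_right _ hn
    calc Module.finrank ℂ K ≤ (s + 1) * (s + 1) := h1
      _ ≤ 16 * (s + 1) := h2
      _ ≤ 16 * m * Nat.sqrt (s + 1) + 16 * (s + 1) := Nat.le_add_left _ _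
  rw [flagCheap_iff_wordTame _ (isAffine_patPencil pos)] at hFC
  obtain ⟨K, k, hdim, hW⟩ := hFC
  -- the words of length `≤ n − 1` with `> k` tops vanish on `K` …
  have hK : ∀ x v : Fin (s + 1) × Fin (s + 1) → ℂ, v ∈ K →
      ∀ w ∈ {w : List Bool | w.length ≤ s + 1 - 1 ∧ k < w.count true}, word (patTop pos x) (patTop pos v) w = 0 := by
    intro x v hv w hw
    by_contra hne
    have h := hW x v hv
    rw [patPencil_map_eval, linPart_patPencil] at h
    exact not_wordTame_of_word _ _ w hne hw.2 hw.1 h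
  -- … hence (Lemma A) on a coordinate set `E` with `dim K ≤ |E|`
  obtain ⟨E, hKE, hE⟩ := words_vanish_on_coordinate_of_vanish pos hinj hup K _ hK
  -- each row path meets `E` in at most `k` edges (Lemma B)
  have hrow : ∀ a : Fin (s + 1),
      (Finset.univ.filter fun i : Fin s => ((a, i.castSucc) : Fin (s + 1) × Fin (s + 1)) ∈ E).card ≤ k := by
    intro a
    by_contra hlt
    push Not at hlt
    cases s with
    | zero => simp at hlt
    | succ s' =>
      have hch := isChain_rowPath V X a
      have hne : (List.ofFn fun i : Fin (s' + 1) => ((a, i.castSucc) : Fin (s' + 2) × Fin (s' + 2))) ≠ [] := by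
        simp
      refine word_indicator_ne_zero_of_isChain pos E _ hne hch
        (hE (fun _ => 1) (fun d => if d ∈ E then 1 else 0) (fun c hc => if_neg hc) _ ⟨?_, ?_⟩)
      · simp
      · rw [List.map_ofFn, count_true_ofFn]
        simpa using hlt
  -- so each fibre of `E` over the row index has at most `k + 1` elements …
  have hfib : ∀ a : Fin (s + 1), (E.filter fun c => c.1 = a).card ≤ k + 1 := by
    intro a
    have hsub : E.filter (fun c => c.1 = a) ⊆ insert (a, Fin.last s)
        ((Finset.univ.filter fun i : Fin s => ((a, i.castSucc) : Fin (s + 1) × Fin (s + 1)) ∈ E).image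
          fun i => (a, i.castSucc)) := by
      intro c hc
      rw [Finset.mem_filter] at hc
      obtain ⟨hcE, hca⟩ := hc
      rw [Finset.mem_insert, Finset.mem_image]
      rcases Fin.eq_castSucc_or_eq_last c.2 with ⟨i, hi⟩ | hlast
      · right
        have hci : c = (a, i.castSucc) := Prod.ext hca hi
        refine ⟨i, ?_, hci.symm⟩
        rw [Finset.mem_filter]
        exact ⟨Finset.mem_univ _, hci ▸ hcE⟩
      · left
        exact Prod.ext hca hlast
    calc (E.filter fun c => c.1 = a).card
        ≤ (insert (a, Fin.last s) ((Finset.univ.filter fun i : Fin s =>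
            ((a, i.castSucc) : Fin (s + 1) × Fin (s + 1)) ∈ E).image fun i => (a, i.castSucc))).card :=
          Finset.card_le_card hsub
      _ ≤ ((Finset.univ.filter fun i : Fin s => ((a, i.castSucc) : Fin (s + 1) × Fin (s + 1)) ∈ E).image
            fun i => (a, i.castSucc)).card + 1 := Finset.card_insert_le _ _
      _ ≤ (Finset.univ.filter fun i : Fin s => ((a, i.castSucc) : Fin (s + 1) × Fin (s + 1)) ∈ E).card + 1 :=
          Nat.add_le_add_right Finset.card_image_le 1
      _ ≤ k + 1 := Nat.add_le_add_right (hrow a) 1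
  -- … and `|E| ≤ (s+1)(k+1)`, contradicting `(k+1)(s+1) < dim K ≤ |E|`
  have hcardE : E.card ≤ (s + 1) * (k + 1) := by
    calc E.card = ∑ a : Fin (s + 1), (E.filter fun c => c.1 = a).card :=
          Finset.card_eq_sum_card_fiberwise fun c _ => Finset.mem_univ c.1
      _ ≤ ∑ _a : Fin (s + 1), (k + 1) := Finset.sum_le_sum fun a _ => hfib a
      _ = (s + 1) * (k + 1) := by simp
  have h3 : (k + 1) * (s + 1) = (s + 1) * (k + 1) := Nat.mul_comm _ _
  omega

/-- **Monotonicity in `m` for placements**: a path placement into `m × m` embeds into `m' × m'`, `m ≤ m'` — the same certificate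
refutes `HeavyTopInst (s+1) m'`. -/
theorem not_heavyTopInst_of_placement_le {m' : ℕ} (hmm' : m ≤ m') (hn : s + 1 ≤ 16) (V : Fin (s + 1) → Fin (s + 1) → Fin m)
    (X : Fin (s + 1) → Fin m × Fin m) (hinj : Function.Injective (placement V X))
    (hup : ∀ c, (placement V X c).1 < (placement V X c).2) : ¬ HeavyTopInst (s + 1) m' := by
  let e : Fin m → Fin m' := Fin.castLE hmm'
  have he : Function.Injective e := Fin.castLE_injective hmm'
  have hplace : ∀ c, placement (fun a i => e (V a i)) (fun a => (e (X a).1, e (X a).2)) c =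
      (e (placement V X c).1, e (placement V X c).2) := by
    intro c
    unfold placement
    split_ifs <;> rfl
  refine not_heavyTopInst_of_placement hn (fun a i => e (V a i)) (fun a => (e (X a).1, e (X a).2)) ?_ ?_
  · intro c d hcd
    rw [hplace, hplace] at hcd
    apply hinj
    exact Prod.ext (he (Prod.mk.inj hcd).1) (he (Prod.mk.inj hcd).2)
  · intro c
    rw [hplace]
    exact (Fin.castLE_lt_castLE_iff hmm').2 (hup c)

end Placement

end Summit.ValiantsHypothesis.ValiantsHypothesis.Theorems.GrenetZeon.RadicalSplit

end
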